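import Literature.NumberTheory.DiophantineGeometry.AbelianSchemeModelReduction
import HarnessLib

/-!
# The reduction map of an abelian-scheme model commutes with homomorphisms; the reduction isomorphism on torsion
# (Serre–Tate 1968, §1; Shimura 1998, §11.1 Prop. 12 / Prop. 14 (i))

Topic `Literature/NumberTheory/DiophantineGeometry`, namespace `Literature.NumberTheory.DiophantineGeometry`.
THEOREMS ONLY (no definition, no named fact; net Literature debt **0**).  Cell `hodgecm-mathlib` (D-0151), background
programme R-pkg (director BATCH 67/68; B-p20 SPEC-Rpkg v0, pieces **T6** «endomorphisms» and **T2** «torsion-level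
equivalences»), serving row VI-NOS r₂′ (the `ℓ`-adic specialisation datum `TateSpecialisation` of a PRODUCED good-reduction
datum: field `equiv_tateModuleMap`, «`M_l(λ) = M_l(λ̃)`») and later II-1-S5c.

Setting: the tree's reduction map `red_v = h.specialFibreReductionHom : B(K̄) →+ 𝒜_v(κ̄(v))` of an abelian-scheme model
`h : IsAbelianSchemeModel B v 𝒜` (file `AbelianSchemeModelReduction`: `B(K̄) → B(K̄_v) = 𝒜(K̄_v) = 𝒜(R) → 𝒜(κ(R)) ≃ 𝒜_v(κ̄(v))`,
`R` the rank-one valuation ring of `K̄_v`, valuative criterion of properness).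

## What is here

* §1 `extendPoint_comp_hom`, `reducePointMonoidHom_comp_hom` — the valuative-criterion extension / reduction of points of a
  proper `O`-scheme is natural in MORPHISMS OF THE SCHEME (uniqueness of the extension; the file `ProperIntegralPoints` has
  naturality in automorphisms of the base only).
* §2 the four naturalities of the layers of `red_v` for a morphism of models `F : 𝒜 ⟶ ℬ` with generic fibre
  `f : A → B` (through the models' chosen generic isomorphisms, hypothesis `hFf`) and special fibre `F_v : 𝒜_v → ℬ_v`
  (hypothesis `hFv`; the special fibre is the pull-back DEFINITIONALLY): `toAdicCompletionPoints_map`,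
  `fractionFieldPointsEquiv_comp`, `fractionFieldPointsEquiv_symm_map`, `reductionHom_map`,
  `residueFieldPointsEquiv_comp`, `specialFibrePointsEquiv_comp`, `additiveResidueFieldPointsEquiv_comp`.
* §3 **`IsAbelianSchemeModel.specialFibreReductionHom_geomPointsMap`** — `red_v (f x) = F_v (red_v x)`: the reduction map
  commutes with homomorphisms which extend to the models (Serre–Tate §1: the reduction map is functorial; Shimura §11.1
  Prop. 12: «the reduction `λ̃` of `λ`»; this is the torsion-level content of Prop. 14 (i) «`M_l(λ) = M_l(λ̃)`»), with the
  endomorphism form `…_geomPointsMap_end` and the torsion-restricted form `…_geomPointsMap_of_mem_geomTorsion`.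
* §4 **`IsAbelianSchemeModel.exists_addEquiv_geomTorsion`** — from bijectivity of `red_v` on `N`-torsion (the ONE geometric
  input of the programme, piece T1, taken here as the hypothesis `hbij`) the additive isomorphism
  `e : B[N](K̄) ≃+ 𝒜_v[N](κ̄(v))` with `(e x : 𝒜_v(κ̄)) = red_v x` (Serre–Tate §1 Lemma 2 «the reduction map defines an
  isomorphism of `A_m^{I}` onto `Ã_m`»), uniqueness of such `e`, and the transition compatibilities `e (ℓ • x) = ℓ • e x`
  the Tate-module packaging (piece T3) consumes.

HC_CM is proved only modulo the 7 printed citations until rung 0 closes; nothing here changes that.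

## References

* [SerreTate1968GoodReduction] J.-P. Serre, J. Tate, *Good reduction of abelian varieties*, Ann. of Math. 88 (1968),
  §1, Thm. 1 and Lemma 2 (reduction map, its functoriality, isomorphism on prime-to-`p` torsion).
* [Shimura1998] G. Shimura, *Abelian Varieties with Complex Multiplication and Modular Functions*, Princeton 1998,
  §11.1 Prop. 12 and Prop. 14 (i) (pp. 83–87).
* [Hartshorne1977] R. Hartshorne, *Algebraic Geometry*, II.4.7 (valuative criterion of properness).
-/

set_option autoImplicit false

noncomputable section

open CategoryTheory AlgebraicGeometry IsDedekindDomain IsDedekindDomain.HeightOneSpectrum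
open scoped MonObj NumberField CategoryTheory.Obj AddSubgroup
open Literature.AlgebraicGeometry.Motives (AbelianVariety SchemeOver AlgPoints specOver
  specValuationSubring specRingHomOver specRingHomι specFractionField specFractionFieldι
  restrictPoint extendPoint reducePointMonoidHom)
open Literature.AlgebraicGeometry.Motives.AbelianVariety
open Literature.NumberTheory.GaloisRepresentations
open Literature.NumberTheory.EllipticCurves

namespace Literature.NumberTheory.DiophantineGeometry

universe u

/-! ## §1 Extension and reduction of points of a proper scheme are natural in morphisms of the scheme -/

section ProperNaturality

variable {O : Type u} [CommRing O] {Ω : Type u} [Field Ω] (R : ValuationSubring Ω) (f : O →+* R)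
  {𝒳 𝒴 : SchemeOver O}

/-- **Uniqueness makes extension natural in the scheme**: for a morphism `F : 𝒳 → 𝒴` of proper `O`-schemes and an
`Ω`-point `P` of `𝒳`, the `R`-point extending `P ≫ F` is the extension of `P` followed by `F` (valuative criterion,
uniqueness half). [cite: Hartshorne1977, II.4.7] -/
theorem extendPoint_comp_hom [IsProper 𝒳.hom] [IsProper 𝒴.hom] (P : specFractionField R f ⟶ 𝒳) (F : 𝒳 ⟶ 𝒴) :
    extendPoint R f 𝒴 (P ≫ F) = extendPoint R f 𝒳 P ≫ F := by
  rw [Literature.AlgebraicGeometry.Motives.extendPoint_eq_iff]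
  change specFractionFieldι R f ≫ extendPoint R f 𝒳 P ≫ F = P ≫ F
  rw [← Category.assoc]
  congr 1
  exact Literature.AlgebraicGeometry.Motives.restrictPoint_extendPoint R f 𝒳 P

/-- **The reduction map of points is natural in the scheme**: for a morphism `F : 𝒳 → 𝒴` of proper group `O`-schemes,
`red (P ≫ F) = red P ≫ F` (reduce = extend then specialise; Serre–Tate §1 «the reduction map», BLR §1.2 Prop. 8).
[cite: SerreTate1968GoodReduction, §1] [cite: Hartshorne1977, II.4.7] -/
theorem reducePointMonoidHom_comp_hom [GrpObj 𝒳] [GrpObj 𝒴] [IsProper 𝒳.hom] [IsProper 𝒴.hom] {k : Type u}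
    [CommRing k] (g : R →+* k) (P : specFractionField R f ⟶ 𝒳) (F : 𝒳 ⟶ 𝒴) :
    reducePointMonoidHom R f 𝒴 g (P ≫ F) = reducePointMonoidHom R f 𝒳 g P ≫ F := by
  rw [Literature.AlgebraicGeometry.Motives.reducePointMonoidHom_apply,
    Literature.AlgebraicGeometry.Motives.reducePointMonoidHom_apply, extendPoint_comp_hom, Category.assoc]

end ProperNaturality

/-! ## §2 The layers of `red_v` and a morphism of models -/

section Layers

variable {K : Type} [Field K] [NumberField K] {v : HeightOneSpectrum (𝓞 K)} {A B : AbelianVariety K}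
  {𝒜 ℬ : SchemeOver (valuationSubringAtPrime K v)} [GrpObj 𝒜] [GrpObj ℬ]

omit [GrpObj 𝒜] [GrpObj ℬ] in
/-- `B(K̄) → B(K̄_v)` (extension of scalars of points) commutes with `P ↦ P ≫ f` (functoriality of points,
Mumford §4). [cite: MumfordAV1970, §4 (functor of points)] -/
theorem toAdicCompletionPoints_map (f : A ⟶ B) (P : A.Points (AlgebraicClosure K)) :
    toAdicCompletionPoints B v (AlgPoints.map f.hom.hom.hom P) =
      AlgPoints.map f.hom.hom.hom (toAdicCompletionPoints A v P) := by
  letI := absClosureAlgebra K (v.adicCompletion K)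
  haveI := absClosure_isScalarTower K (v.adicCompletion K)
  change AlgPoints.extendScalars B.X _ _ (P ≫ f.hom.hom.hom) = AlgPoints.extendScalars A.X _ _ P ≫ f.hom.hom.hom
  rw [AlgPoints.extendScalars_apply, AlgPoints.extendScalars_apply, Category.assoc]

/-- **`Hom_{𝓞_{K,v}}(Spec Ω, 𝒜) ≃ A(Ω)` is natural** in a morphism of models `F : 𝒜 → ℬ` whose generic fibre is `f`
through the chosen generic isomorphisms (`hFf`): `e_ℬ(P ≫ F) = e_𝒜(P) ≫ f` (adjunction naturality; universal property of the
fibre product, Hartshorne II.3). [cite: Hartshorne1977, II.3 Thm. 3.3 (fibre product, universal property)] -/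
theorem IsAbelianSchemeModel.fractionFieldPointsEquiv_comp (h : IsAbelianSchemeModel A v 𝒜)
    (h' : IsAbelianSchemeModel B v ℬ) (f : A ⟶ B) (F : 𝒜 ⟶ ℬ)
    (hFf : (genericFibre (valuationSubringAtPrime K v) K).map F ≫ h'.exists_iso.choose.hom =
      h.exists_iso.choose.hom ≫ f.hom.hom.hom)
    (P : specFractionField (closureValuationSubring (v.adicCompletion K)) (toClosureValuationSubring v) ⟶ 𝒜) :
    h'.fractionFieldPointsEquiv (P ≫ F) = AlgPoints.map f.hom.hom.hom (h.fractionFieldPointsEquiv P) := by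
  rw [h'.fractionFieldPointsEquiv_apply, h.fractionFieldPointsEquiv_apply, AlgPoints.map_apply, ← Category.assoc
      (specFractionFieldIso v).inv P F, Adjunction.homEquiv_naturality_right, Category.assoc, hFf, Category.assoc]

/-- The inverse form: `e_ℬ⁻¹(Q ≫ f) = e_𝒜⁻¹(Q) ≫ F`. [cite: Hartshorne1977, II.3 Thm. 3.3 (fibre product, universal property)] -/
theorem IsAbelianSchemeModel.fractionFieldPointsEquiv_symm_map (h : IsAbelianSchemeModel A v 𝒜)
    (h' : IsAbelianSchemeModel B v ℬ) (f : A ⟶ B) (F : 𝒜 ⟶ ℬ)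
    (hFf : (genericFibre (valuationSubringAtPrime K v) K).map F ≫ h'.exists_iso.choose.hom =
      h.exists_iso.choose.hom ≫ f.hom.hom.hom)
    (Q : A.Points (AlgebraicClosure (v.adicCompletion K))) :
    h'.fractionFieldPointsEquiv.symm (AlgPoints.map f.hom.hom.hom Q) = h.fractionFieldPointsEquiv.symm Q ≫ F := by
  apply h'.fractionFieldPointsEquiv.injective
  rw [MulEquiv.apply_symm_apply, h.fractionFieldPointsEquiv_comp h' f F hFf, MulEquiv.apply_symm_apply]

/-- **The reduction map `A(K̄_v) → 𝒜(κ(R))` commutes with `f` / `F`**: `red_ℬ (Q ≫ f) = red_𝒜 Q ≫ F` (valuative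
criterion: extensions are unique, so the extension of `Q ≫ f` is the extension of `Q` followed by `F`).
[cite: SerreTate1968GoodReduction, §1] -/
theorem IsAbelianSchemeModel.reductionHom_map (h : IsAbelianSchemeModel A v 𝒜) (h' : IsAbelianSchemeModel B v ℬ)
    (f : A ⟶ B) (F : 𝒜 ⟶ ℬ)
    (hFf : (genericFibre (valuationSubringAtPrime K v) K).map F ≫ h'.exists_iso.choose.hom =
      h.exists_iso.choose.hom ≫ f.hom.hom.hom)
    (Q : A.Points (AlgebraicClosure (v.adicCompletion K))) :
    h'.reductionHom (AlgPoints.map f.hom.hom.hom Q) = h.reductionHom Q ≫ F := by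
  haveI := h.isProper
  haveI := h'.isProper
  rw [h'.reductionHom_apply, h.reductionHom_apply, h.fractionFieldPointsEquiv_symm_map h' f F hFf Q]
  exact reducePointMonoidHom_comp_hom _ _ _ _ F

omit [GrpObj 𝒜] [GrpObj ℬ] in
/-- `𝒜(κ(R)) ≃ 𝒜_v(κ̄(v))` (re-basing the geometric closed point) is natural in `F`: it is precomposition with a fixed
isomorphism. [cite: Hartshorne1977, II.3 Thm. 3.3 (fibre product, universal property)] -/
theorem residueFieldPointsEquiv_comp [GrpObj 𝒜] [GrpObj ℬ] (y : residueFieldPoints 𝒜) (F : 𝒜 ⟶ ℬ) :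
    residueFieldPointsEquiv v ℬ (y ≫ F) = residueFieldPointsEquiv v 𝒜 y ≫ F := by
  change (geomClosedPointIsoSpecResidueField v).inv ≫ (y ≫ F) ≫ (Iso.refl ℬ).hom =
    ((geomClosedPointIsoSpecResidueField v).inv ≫ y ≫ (Iso.refl 𝒜).hom) ≫ F
  simp only [Iso.refl_hom, Category.comp_id, Category.assoc]

/-- **`𝒜_v(κ̄(v)) = Hom(Spec κ̄(v), 𝒜)` is natural** in `F` whose special fibre is `F_v` (`hFv`; the special fibre is the
pull-back by definition): `e_ℬ(Q ≫ F) = e_𝒜(Q) ≫ F_v` (adjunction naturality; universal property of the fibre product).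
[cite: Hartshorne1977, II.3 Thm. 3.3 (fibre product, universal property)] -/
theorem IsAbelianSchemeModel.specialFibrePointsEquiv_comp (h : IsAbelianSchemeModel A v 𝒜)
    (h' : IsAbelianSchemeModel B v ℬ) (F : 𝒜 ⟶ ℬ) (F_v : h.specialFibre ⟶ h'.specialFibre)
    (hFv : F_v.hom.hom.hom = (specialFibreFunctor v).map F) (Q : specialFibreGeomPoints v 𝒜) :
    h'.specialFibrePointsEquiv (Q ≫ F) = AlgPoints.map F_v.hom.hom.hom (h.specialFibrePointsEquiv Q) := by
  rw [h'.specialFibrePointsEquiv_apply, h.specialFibrePointsEquiv_apply, AlgPoints.map_apply, hFv,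
    ← Category.assoc (geomClosedPointIso v).inv Q F, Adjunction.homEquiv_naturality_right]
  rfl

/-- The additive composite `𝒜(κ(R)) ≃ 𝒜_v(κ̄(v))` (`additiveResidueFieldPointsEquiv`) is natural in `F` / `F_v`
(Serre–Tate §1: the identification of the special fibre's geometric points is functorial). [cite: SerreTate1968GoodReduction, §1] -/
theorem IsAbelianSchemeModel.additiveResidueFieldPointsEquiv_comp (h : IsAbelianSchemeModel A v 𝒜)
    (h' : IsAbelianSchemeModel B v ℬ) (F : 𝒜 ⟶ ℬ) (F_v : h.specialFibre ⟶ h'.specialFibre)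
    (hFv : F_v.hom.hom.hom = (specialFibreFunctor v).map F) (y : residueFieldPoints 𝒜) :
    h'.additiveResidueFieldPointsEquiv (Additive.ofMul (y ≫ F)) =
      Hom.geomPointsMap F_v (h.additiveResidueFieldPointsEquiv (Additive.ofMul y)) := by
  apply Additive.toMul.injective
  rw [Hom.geomPointsMap_apply]
  change h'.specialFibrePointsEquiv (residueFieldPointsEquiv v ℬ (y ≫ F)) =
    AlgPoints.map F_v.hom.hom.hom (h.specialFibrePointsEquiv (residueFieldPointsEquiv v 𝒜 y))
  rw [residueFieldPointsEquiv_comp, h.specialFibrePointsEquiv_comp h' F F_v hFv]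

end Layers

/-! ## §3 `red_v` commutes with homomorphisms extending to the models -/

section Functoriality

variable {K : Type} [Field K] [NumberField K] {v : HeightOneSpectrum (𝓞 K)} {A B : AbelianVariety K}
  {𝒜 ℬ : SchemeOver (valuationSubringAtPrime K v)} [GrpObj 𝒜] [GrpObj ℬ]

/-- **The reduction map commutes with homomorphisms** (Serre–Tate 1968 §1; Shimura 1998 §11.1 Prop. 12 «the reduction
`λ̃` of `λ`», and the torsion-level content of Prop. 14 (i) «`M_l(λ) = M_l(λ̃)`»): for abelian-scheme models `𝒜` of `A` and
`ℬ` of `B` at `v`, a homomorphism `f : A → B`, a morphism of models `F : 𝒜 → ℬ` whose generic fibre is `f` through the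
models' generic isomorphisms (`hFf`) and whose special fibre is `F_v : 𝒜_v → ℬ_v` (`hFv`),
`red_v (f x) = F_v (red_v x)` for every geometric point `x ∈ A(K̄)`.  (For the Néron extension `F` of `f` both hypotheses
hold by construction — B-p07's produced datum / piece T7.)
[cite: SerreTate1968GoodReduction, §1] [cite: Shimura1998, §11.1 Prop. 12 and Prop. 14 (i)] -/
theorem IsAbelianSchemeModel.specialFibreReductionHom_geomPointsMap (h : IsAbelianSchemeModel A v 𝒜)
    (h' : IsAbelianSchemeModel B v ℬ) (f : A ⟶ B) (F : 𝒜 ⟶ ℬ) (F_v : h.specialFibre ⟶ h'.specialFibre)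
    (hFf : (genericFibre (valuationSubringAtPrime K v) K).map F ≫ h'.exists_iso.choose.hom =
      h.exists_iso.choose.hom ≫ f.hom.hom.hom)
    (hFv : F_v.hom.hom.hom = (specialFibreFunctor v).map F) (x : A.geomPoints) :
    h'.specialFibreReductionHom (Hom.geomPointsMap f x) = Hom.geomPointsMap F_v (h.specialFibreReductionHom x) := by
  rw [h'.specialFibreReductionHom_apply, h.specialFibreReductionHom_apply, h'.geomReductionHom_apply,
    h.geomReductionHom_apply, Hom.geomPointsMap_apply, toAdicCompletionPoints_map, h.reductionHom_map h' f F hFf,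
    h.additiveResidueFieldPointsEquiv_comp h' F F_v hFv]

/-- **Endomorphism form** (`A = B`, `𝒜 = ℬ`): `red_v (f x) = F_v (red_v x)` for an endomorphism `f` of `A` extending to an
endomorphism `F` of the model with special fibre `F_v` — the torsion-level statement behind the field
`equiv_tateModuleMap` of `GoodReductionAt.TateSpecialisation` for a produced datum (`redEnd f = F_v`).
[cite: Shimura1998, §11.1 Prop. 14 (i)] [cite: SerreTate1968GoodReduction, §1] -/
theorem IsAbelianSchemeModel.specialFibreReductionHom_geomPointsMap_end (h : IsAbelianSchemeModel A v 𝒜)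
    (f : A ⟶ A) (F : 𝒜 ⟶ 𝒜) (F_v : h.specialFibre ⟶ h.specialFibre)
    (hFf : (genericFibre (valuationSubringAtPrime K v) K).map F ≫ h.exists_iso.choose.hom =
      h.exists_iso.choose.hom ≫ f.hom.hom.hom)
    (hFv : F_v.hom.hom.hom = (specialFibreFunctor v).map F) (x : A.geomPoints) :
    h.specialFibreReductionHom (Hom.geomPointsMap f x) = Hom.geomPointsMap F_v (h.specialFibreReductionHom x) :=
  h.specialFibreReductionHom_geomPointsMap h f F F_v hFf hFv x

/-- **Torsion form**: for `x ∈ A[N](K̄)`, `f x ∈ B[N](K̄)`, `red_v x ∈ 𝒜_v[N]`, `F_v (red_v x) ∈ ℬ_v[N]`, and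
`red_v (f x) = F_v (red_v x)` — the square the Tate-module packaging transfers to `T_ℓ` (piece T3).
[cite: Shimura1998, §11.1 Prop. 14 (i)] -/
theorem IsAbelianSchemeModel.specialFibreReductionHom_geomPointsMap_of_mem_geomTorsion (h : IsAbelianSchemeModel A v 𝒜)
    (h' : IsAbelianSchemeModel B v ℬ) (f : A ⟶ B) (F : 𝒜 ⟶ ℬ) (F_v : h.specialFibre ⟶ h'.specialFibre)
    (hFf : (genericFibre (valuationSubringAtPrime K v) K).map F ≫ h'.exists_iso.choose.hom =
      h.exists_iso.choose.hom ≫ f.hom.hom.hom)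
    (hFv : F_v.hom.hom.hom = (specialFibreFunctor v).map F) {N : ℕ} {x : A.geomPoints}
    (hx : x ∈ A.geomTorsion N) :
    Hom.geomPointsMap f x ∈ B.geomTorsion N ∧ h.specialFibreReductionHom x ∈ h.specialFibre.geomTorsion N ∧
      h'.specialFibreReductionHom (Hom.geomPointsMap f x) = Hom.geomPointsMap F_v (h.specialFibreReductionHom x) := by
  refine ⟨?_, ?_, h.specialFibreReductionHom_geomPointsMap h' f F F_v hFf hFv x⟩
  · rw [mem_geomTorsion_iff'] at hx ⊢
    rw [← map_zsmul, hx, map_zero]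
  · rw [mem_geomTorsion_iff'] at hx ⊢
    rw [← map_zsmul, hx, map_zero]

end Functoriality

/-! ## §4 The reduction isomorphism on `N`-torsion (from bijectivity) -/

section TorsionEquiv

variable {K : Type} [Field K] [NumberField K] {v : HeightOneSpectrum (𝓞 K)} {B : AbelianVariety K}
  {𝒜 : SchemeOver (valuationSubringAtPrime K v)} [GrpObj 𝒜]

/-- `red_v` maps `N`-torsion into `N`-torsion (it is additive). [cite: SerreTate1968GoodReduction, §1] -/
theorem IsAbelianSchemeModel.specialFibreReductionHom_mem_geomTorsion (h : IsAbelianSchemeModel B v 𝒜) {N : ℕ}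
    {x : B.geomPoints} (hx : x ∈ B.geomTorsion N) : h.specialFibreReductionHom x ∈ h.specialFibre.geomTorsion N := by
  rw [mem_geomTorsion_iff'] at hx ⊢
  rw [← map_zsmul, hx, map_zero]

/-- **Serre–Tate §1 Lemma 2, packaged: the reduction isomorphism `B[N](K̄) ≃+ 𝒜_v[N](κ̄(v))`.**  If `red_v` is bijective
from `B[N](K̄)` onto `𝒜_v[N](κ̄(v))` (`hbij` — for `N` prime to `v` this is the geometric input «`[N]` is finite étale on the
model», piece T1 of the programme), there is an additive isomorphism `e` of the `N`-torsion groups with `(e x : 𝒜_v(κ̄)) = red_v x`.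
[cite: SerreTate1968GoodReduction, §1 Lemma 2] -/
theorem IsAbelianSchemeModel.exists_addEquiv_geomTorsion (h : IsAbelianSchemeModel B v 𝒜) {N : ℕ}
    (hbij : Set.BijOn h.specialFibreReductionHom (B.geomTorsion N) (h.specialFibre.geomTorsion N)) :
    ∃ e : B.geomTorsion N ≃+ h.specialFibre.geomTorsion N,
      ∀ x : B.geomTorsion N, ((e x : h.specialFibre.geomTorsion N) : h.specialFibre.geomPoints) =
        h.specialFibreReductionHom x := by
  -- the restriction of `red_v` to the torsion subgroups
  let r : B.geomTorsion N →+ h.specialFibre.geomTorsion N :=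
    { toFun := fun x => ⟨h.specialFibreReductionHom x, hbij.mapsTo x.2⟩
      map_zero' := Subtype.ext (by simp)
      map_add' := fun x y => Subtype.ext (by simp) }
  have hr : Function.Bijective r := by
    constructor
    · intro x y hxy
      exact Subtype.ext (hbij.injOn x.2 y.2 (congrArg Subtype.val hxy))
    · intro y
      obtain ⟨x, hx, hxy⟩ := hbij.surjOn y.2
      exact ⟨⟨x, hx⟩, Subtype.ext hxy⟩
  exact ⟨AddEquiv.ofBijective r hr, fun x => rfl⟩

/-- **Uniqueness**: an additive isomorphism of the `N`-torsion groups lying over `red_v` is determined (any two agree).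
[cite: SerreTate1968GoodReduction, §1 Lemma 2] -/
theorem IsAbelianSchemeModel.addEquiv_geomTorsion_unique (h : IsAbelianSchemeModel B v 𝒜) {N : ℕ}
    (e e' : B.geomTorsion N ≃+ h.specialFibre.geomTorsion N)
    (he : ∀ x : B.geomTorsion N, ((e x : h.specialFibre.geomTorsion N) : h.specialFibre.geomPoints) =
      h.specialFibreReductionHom x)
    (he' : ∀ x : B.geomTorsion N, ((e' x : h.specialFibre.geomTorsion N) : h.specialFibre.geomPoints) =
      h.specialFibreReductionHom x) : e = e' :=
  AddEquiv.ext fun x => Subtype.ext ((he x).trans (he' x).symm)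

/-- **Transition square for the Tate module**: for `x ∈ B[ℓ^(n+1)](K̄)`, `ℓ • x ∈ B[ℓ^n](K̄)` and the isomorphisms at
levels `n + 1` and `n` over `red_v` satisfy `e_n (ℓ • x) = ℓ • e_{n+1} x` in `𝒜_v(κ̄)` (both are `red_v (ℓ • x)`).
[cite: SerreTate1968GoodReduction, §1 Lemma 2] -/
theorem IsAbelianSchemeModel.addEquiv_geomTorsion_nsmul_compat (h : IsAbelianSchemeModel B v 𝒜) {ℓ n : ℕ}
    (e : B.geomTorsion (ℓ ^ n) ≃+ h.specialFibre.geomTorsion (ℓ ^ n))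
    (e' : B.geomTorsion (ℓ ^ (n + 1)) ≃+ h.specialFibre.geomTorsion (ℓ ^ (n + 1)))
    (he : ∀ x : B.geomTorsion (ℓ ^ n), ((e x : h.specialFibre.geomTorsion (ℓ ^ n)) : h.specialFibre.geomPoints) =
      h.specialFibreReductionHom x)
    (he' : ∀ x : B.geomTorsion (ℓ ^ (n + 1)),
      ((e' x : h.specialFibre.geomTorsion (ℓ ^ (n + 1))) : h.specialFibre.geomPoints) = h.specialFibreReductionHom x)
    (x : B.geomTorsion (ℓ ^ (n + 1))) (hℓx : ℓ • (x : B.geomPoints) ∈ B.geomTorsion (ℓ ^ n)) :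
    ((e ⟨ℓ • (x : B.geomPoints), hℓx⟩ : h.specialFibre.geomTorsion (ℓ ^ n)) : h.specialFibre.geomPoints) =
      ℓ • ((e' x : h.specialFibre.geomTorsion (ℓ ^ (n + 1))) : h.specialFibre.geomPoints) := by
  rw [he, he', map_nsmul]

/-- `ℓ • x ∈ B[ℓ^n]` for `x ∈ B[ℓ^(n+1)]` (the transition map of the Tate tower `T_ℓ = lim A[ℓⁿ]`, Serre–Tate §1).
[cite: SerreTate1968GoodReduction, §1 (definition of T_ℓ)] -/
theorem _root_.Literature.AlgebraicGeometry.Motives.AbelianVariety.nsmul_mem_geomTorsion_pow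
    {k : Type} [Field k] (C : AbelianVariety k) {ℓ n : ℕ} {x : C.geomPoints} (hx : x ∈ C.geomTorsion (ℓ ^ (n + 1))) :
    ℓ • x ∈ C.geomTorsion (ℓ ^ n) := by
  rw [mem_geomTorsion_iff'] at hx ⊢
  rw [← natCast_zsmul x ℓ, smul_smul, ← pow_succ, hx]

/-- **Compatibility of the torsion isomorphisms with homomorphisms** (the square T3 transfers to `T_ℓ`): for
`e_A`, `e_B` over `red_v` at level `N` and `f`, `F`, `F_v` as in `specialFibreReductionHom_geomPointsMap`,
`e_B (f x) = F_v (e_A x)` in `ℬ_v(κ̄)`. [cite: Shimura1998, §11.1 Prop. 14 (i)] -/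
theorem IsAbelianSchemeModel.addEquiv_geomTorsion_geomPointsMap {A : AbelianVariety K}
    {ℬ : SchemeOver (valuationSubringAtPrime K v)} [GrpObj ℬ] (h : IsAbelianSchemeModel A v 𝒜)
    (h' : IsAbelianSchemeModel B v ℬ) (f : A ⟶ B) (F : 𝒜 ⟶ ℬ) (F_v : h.specialFibre ⟶ h'.specialFibre)
    (hFf : (genericFibre (valuationSubringAtPrime K v) K).map F ≫ h'.exists_iso.choose.hom =
      h.exists_iso.choose.hom ≫ f.hom.hom.hom)
    (hFv : F_v.hom.hom.hom = (specialFibreFunctor v).map F) {N : ℕ}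
    (eA : A.geomTorsion N ≃+ h.specialFibre.geomTorsion N) (eB : B.geomTorsion N ≃+ h'.specialFibre.geomTorsion N)
    (heA : ∀ x : A.geomTorsion N, ((eA x : h.specialFibre.geomTorsion N) : h.specialFibre.geomPoints) =
      h.specialFibreReductionHom x)
    (heB : ∀ y : B.geomTorsion N, ((eB y : h'.specialFibre.geomTorsion N) : h'.specialFibre.geomPoints) =
      h'.specialFibreReductionHom y)
    (x : A.geomTorsion N) (hfx : Hom.geomPointsMap f x ∈ B.geomTorsion N) :
    ((eB ⟨Hom.geomPointsMap f x, hfx⟩ : h'.specialFibre.geomTorsion N) : h'.specialFibre.geomPoints) =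
      Hom.geomPointsMap F_v ((eA x : h.specialFibre.geomTorsion N) : h.specialFibre.geomPoints) := by
  rw [heB, heA]
  exact h.specialFibreReductionHom_geomPointsMap h' f F F_v hFf hFv x

end TorsionEquiv

/-! ## §5 Appended (B-p19): the `hend` input of R-pkg T7b in its VERBATIM shape (`f : End A`, `F_K = e ≫ f ≫ e⁻¹`, torsion binder) -/

section HendShape

variable {K : Type} [Field K] [NumberField K] {v : HeightOneSpectrum (𝓞 K)} {A : AbelianVariety K}
  {𝒜 : SchemeOver (valuationSubringAtPrime K v)} [GrpObj 𝒜]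

/-- **The one-model, `End A` form in the conjugation currency** (the `hend` input of
`AbelianVariety.exists_goodReductionAt_tateSpecialisation_of_isAbelianSchemeModel`, R-pkg T7b, VERBATIM shape): for an
endomorphism `F` of the model `𝒜` whose generic fibre is `e ≫ f ≫ e⁻¹` for `f ∈ End(A)` and the chosen identification
`e = h.exists_iso.choose`, and whose special fibre is `r`, the reduction map intertwines `f` and `r` on (torsion) geometric
points — [Shimura1998] §11.1 Prop. 14 (i) «`(λx)~ = λ̃ x̃`» with `λ ∈ End(A)`.  (The torsion hypothesis is not used.)
[cite: Shimura1998, §11.1 Prop. 14 (i) (§11, pp. 83–87)] -/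
theorem IsAbelianSchemeModel.specialFibreReductionHom_geomPointsMap_end' (h : IsAbelianSchemeModel A v 𝒜) (ℓ : ℕ)
    (F : 𝒜 ⟶ 𝒜) (f : End A) (r : h.specialFibre ⟶ h.specialFibre)
    (hF : (genericFibre (valuationSubringAtPrime K v) K).map F =
      h.exists_iso.choose.hom ≫ f.hom.hom.hom ≫ h.exists_iso.choose.inv)
    (hr : r.hom.hom.hom = (specialFibreFunctor v).map F) (n : ℕ) (x : A.geomPoints)
    (_hx : x ∈ A.geomTorsion (ℓ ^ n : ℕ)) :
    h.specialFibreReductionHom (Hom.geomPointsMap (f : A ⟶ A) x) =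
      Hom.geomPointsMap r (h.specialFibreReductionHom x) :=
  h.specialFibreReductionHom_geomPointsMap_end (f : A ⟶ A) F r
    (by rw [hF, Category.assoc, Category.assoc, Iso.inv_hom_id, Category.comp_id]) hr x

/-- The `hend` input of R-pkg T7b as a closed term (quantified over `F`, `f`, `r`, `n`, `x`), for `T7b`'s one-liner.
[cite: Shimura1998, §11.1 Prop. 14 (i) (§11, pp. 83–87)] -/
theorem IsAbelianSchemeModel.specialFibreReductionHom_hend (h : IsAbelianSchemeModel A v 𝒜) (ℓ : ℕ) :
    ∀ (F : 𝒜 ⟶ 𝒜) (f : End A) (r : h.specialFibre ⟶ h.specialFibre),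
      (genericFibre (valuationSubringAtPrime K v) K).map F =
          h.exists_iso.choose.hom ≫ f.hom.hom.hom ≫ h.exists_iso.choose.inv →
      r.hom.hom.hom = (specialFibreFunctor v).map F →
      ∀ (n : ℕ) (x : A.geomPoints), x ∈ A.geomTorsion (ℓ ^ n : ℕ) →
        h.specialFibreReductionHom (Hom.geomPointsMap (f : A ⟶ A) x) =
          Hom.geomPointsMap r (h.specialFibreReductionHom x) :=
  fun F f r hF hr n x hx => h.specialFibreReductionHom_geomPointsMap_end' ℓ F f r hF hr n x hx

end HendShape

end Literature.NumberTheory.DiophantineGeometry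

end
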